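import Mathlib
import Summits.ValiantsHypothesis.ValiantsHypothesis.Theorems.GirthSidonMomentCurveElusiveDepthDichotomy

/-!
# One cover theorem for all non-deep 2×2-initiated targets (supports `stub_swallowedInSmallSumset`,
crux `MomentCurveElusive`, item stmt-ValiantsHypothesis-6534, route GirthSidon, line `registered`)

Consolidation of p173839 (cross-witnessed cover), p174013 (product-depth cover) and p174145 (depth
dichotomy) into a single statement with hypotheses directly on the 2×2 cancellations.

`exists_small_cover_of_twoByTwo`: sources `u_1, …, u_n ∈ K⟦X⟧` with nonzero constant terms, weights
`o`, and `m` born targets, each INITIATED BY A 2×2 CANCELLATION — `D_i = o_{a_i} + o_{b_i} + γ_i` over a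
balanced weight `o_a + o_b = o_c + o_d` with `γ_i = ord(u_a u_b − u_c u_d)` (exact gadgets and gadgets
cleaned by higher-weight products alike) — and NOT DEEP: whenever the cancellation is resonant
(`δ(a,c) = δ(b,d) = g₁ < γ`, `δ(a,d) = δ(b,c) = g₂ < γ`, `δ(x,z) = ord(u_x − u_z)`) its depth is the product
depth `γ = g₁ + g₂`.  Then `D ⊆ U + U` with `|U| ≤ n (log₂ n + 1)²`.

So, for the cover statement of the line, 2×2-initiated cancellation costs at most a factor `(log₂ n + 1)²`
over the toric cover `U = O` — except for DEEP or LINEAR-DEPTH resonances (`γ ≠ g₁ + g₂`), which are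
the named residual (LEAD-ANALYSIS-c5.md §6; one such target is on record, interval-G2 depth `3q`).
Proof: heavy–light attribution on the `t`-adic ultrametric (light radii, `light_or_light`,
`two_pow_card_light_le`), the dichotomy `gadget_depth_dichotomy`, and the eight-bit case analysis of the
product case (`prodDepth_core_lt/eq/gt`, isosceles `order_sub_eq_of_lt`).
-/

-- (Sub = Summit), so the duplicated namespace component is intended.
set_option linter.dupNamespace false

namespace Summit.ValiantsHypothesis.ValiantsHypothesis.Theorems

open PowerSeries Finset

section TwoByTwo

variable {K : Type*} [Field K]

/-- **Small sumset cover for all non-deep 2×2-initiated targets.**  See the module docstring.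
[folklore] -/
theorem exists_small_cover_of_twoByTwo {n m : ℕ} (u : Fin n → K⟦X⟧)
    (hu : ∀ j, constantCoeff (u j) ≠ 0) (o : Fin n → ℕ)
    (a b c d : Fin m → Fin n) (D γ : Fin m → ℕ)
    (hD : ∀ i, D i = o (a i) + o (b i) + γ i)
    (hw : ∀ i, o (a i) + o (b i) = o (c i) + o (d i))
    (hγ : ∀ i, (u (a i) * u (b i) - u (c i) * u (d i)).order = γ i)
    (hnd : ∀ i (g₁ g₂ : ℕ), (u (a i) - u (c i)).order = g₁ → (u (b i) - u (d i)).order = g₁ →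
      (u (a i) - u (d i)).order = g₂ → (u (b i) - u (c i)).order = g₂ → g₁ < γ i → g₂ < γ i →
      γ i = g₁ + g₂) :
    ∃ U : Finset ℕ, U.card ≤ n * (Nat.log 2 n + 1) ^ 2 ∧ ∀ i, ∃ p ∈ U, ∃ q ∈ U, D i = p + q := by
  classical
  -- a bound on the depths (all distances used are ≤ γ i)
  set G : ℕ := (univ.image γ).sup id + 1 with hG
  have hγG : ∀ i, γ i < G := by
    intro i
    have : γ i ≤ (univ.image γ).sup id := le_sup (f := id) (mem_image_of_mem γ (mem_univ i))
    omega
  -- light radii of a source, with `0` adjoined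
  set L : Fin n → Finset ℕ := fun x => insert 0 ((range G).filter fun g =>
    2 * (univ.filter fun y => ((g + 1 : ℕ) : ℕ∞) ≤ (u x - u y).order).card ≤
      (univ.filter fun y => (g : ℕ∞) ≤ (u x - u y).order).card) with hL
  have hLcard : ∀ x, (L x).card ≤ Nat.log 2 n + 1 := by
    intro x
    rw [hL]
    refine le_trans (card_insert_le _ _) ?_
    simpa using Nat.le_log_of_pow_le (by norm_num) (two_pow_card_light_le u x G)
  have hL0 : ∀ x, 0 ∈ L x := fun x => by rw [hL]; exact mem_insert_self _ _
  have hLlight : ∀ x g, g < G →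
      2 * (univ.filter fun y => ((g + 1 : ℕ) : ℕ∞) ≤ (u x - u y).order).card ≤
        (univ.filter fun y => (g : ℕ∞) ≤ (u x - u y).order).card → g ∈ L x := by
    intro x g hg hl
    rw [hL]
    exact mem_insert_of_mem (mem_filter.2 ⟨mem_range.2 hg, hl⟩)
  -- membership from a witnessing couple
  have hwit : ∀ x z g, g < G → (u x - u z).order = g → g ∈ L x ∨ g ∈ L z := by
    intro x z g hg hxz
    exact (light_or_light u x z g hxz).imp (hLlight x g hg) (hLlight z g hg)
  -- the cover
  set U : Finset ℕ := univ.biUnion fun x => ((L x) ×ˢ (L x)).image fun p => o x + p.1 + p.2 with hU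
  have hmemU : ∀ x g g', g ∈ L x → g' ∈ L x → o x + g + g' ∈ U := fun x g g' hg hg' =>
    mem_biUnion.2 ⟨x, mem_univ x, mem_image.2 ⟨(g, g'), mem_product.2 ⟨hg, hg'⟩, rfl⟩⟩
  refine ⟨U, ?_, ?_⟩
  · -- size
    calc U.card ≤ ∑ x : Fin n, (((L x) ×ˢ (L x)).image fun p => o x + p.1 + p.2).card :=
          card_biUnion_le
      _ ≤ ∑ _x : Fin n, (Nat.log 2 n + 1) ^ 2 := by
          gcongr with x
          refine le_trans card_image_le ?_
          rw [card_product, sq]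
          exact Nat.mul_le_mul (hLcard x) (hLcard x)
      _ = n * (Nat.log 2 n + 1) ^ 2 := by
          rw [sum_const, card_univ, Fintype.card_fin, smul_eq_mul]
  · -- cover
    intro i
    -- attribution inside a pair `{x, y}` at the right weight, two depths
    have attrib : ∀ (x y : Fin n) (g g' : ℕ), D i = o x + o y + g + g' →
        (g ∈ L x ∨ g ∈ L y) → (g' ∈ L x ∨ g' ∈ L y) →
        ∃ p ∈ U, ∃ q ∈ U, D i = p + q := by
      intro x y g g' hxy h1 h2
      rcases h1 with h1 | h1 <;> rcases h2 with h2 | h2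
      · exact ⟨o x + g + g', hmemU _ _ _ h1 h2, o y + 0 + 0, hmemU _ _ _ (hL0 y) (hL0 y),
          by rw [hxy]; ring⟩
      · exact ⟨o x + g + 0, hmemU _ _ _ h1 (hL0 x), o y + g' + 0, hmemU _ _ _ h2 (hL0 y),
          by rw [hxy]; ring⟩
      · exact ⟨o x + g' + 0, hmemU _ _ _ h2 (hL0 x), o y + g + 0, hmemU _ _ _ h1 (hL0 y),
          by rw [hxy]; ring⟩
      · exact ⟨o x + 0 + 0, hmemU _ _ _ (hL0 x) (hL0 x), o y + g + g', hmemU _ _ _ h1 h2,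
          by rw [hxy]; ring⟩
    -- the two presentations of the target at the balanced weight
    have hDab : D i = o (a i) + o (b i) + γ i + 0 := by rw [hD i]; ring
    have hDba : D i = o (b i) + o (a i) + γ i + 0 := by rw [hD i]; ring
    have hDcd : D i = o (c i) + o (d i) + γ i + 0 := by rw [hD i, hw i]; ring
    have hDdc : D i = o (d i) + o (c i) + γ i + 0 := by rw [hD i, hw i]; ring
    rcases gadget_depth_dichotomy (u (a i)) (u (b i)) (u (c i)) (u (d i)) (hu _) (hu _) (hu _)
      (γ i) (hγ i) with hcross | ⟨g₁, g₂, hac, hbd, had, hbc, hlt1, hlt2⟩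
    · -- cross-witnessed: one depth, attributed to an endpoint of the witnessing couple
      rcases hcross with h | h | h | h
      · rcases hwit _ _ _ (hγG i) h with hm | hm
        · exact attrib (a i) (b i) (γ i) 0 hDab (Or.inl hm) (Or.inl (hL0 _))
        · exact attrib (c i) (d i) (γ i) 0 hDcd (Or.inl hm) (Or.inl (hL0 _))
      · rcases hwit _ _ _ (hγG i) h with hm | hm
        · exact attrib (b i) (a i) (γ i) 0 hDba (Or.inl hm) (Or.inl (hL0 _))
        · exact attrib (d i) (c i) (γ i) 0 hDdc (Or.inl hm) (Or.inl (hL0 _))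
      · rcases hwit _ _ _ (hγG i) h with hm | hm
        · exact attrib (a i) (b i) (γ i) 0 hDab (Or.inl hm) (Or.inl (hL0 _))
        · exact attrib (d i) (c i) (γ i) 0 hDdc (Or.inl hm) (Or.inl (hL0 _))
      · rcases hwit _ _ _ (hγG i) h with hm | hm
        · exact attrib (b i) (a i) (γ i) 0 hDba (Or.inl hm) (Or.inl (hL0 _))
        · exact attrib (c i) (d i) (γ i) 0 hDcd (Or.inl hm) (Or.inl (hL0 _))
    · -- resonant and not deep: product depth γ = g₁ + g₂
      have hsum : γ i = g₁ + g₂ := hnd i g₁ g₂ hac hbd had hbc hlt1 hlt2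
      have hg₁G : g₁ < G := lt_trans hlt1 (hγG i)
      have hg₂G : g₂ < G := lt_trans hlt2 (hγG i)
      have hD' : D i = o (a i) + o (b i) + g₁ + g₂ := by rw [hD i, hsum]; ring
      -- the eight lightness bits
      have hA' : g₁ ∈ L (a i) ∨ g₁ ∈ L (c i) := hwit _ _ _ hg₁G hac
      have hB' : g₁ ∈ L (b i) ∨ g₁ ∈ L (d i) := hwit _ _ _ hg₁G hbd
      have hC' : g₂ ∈ L (a i) ∨ g₂ ∈ L (d i) := hwit _ _ _ hg₂G had
      have hE' : g₂ ∈ L (b i) ∨ g₂ ∈ L (c i) := hwit _ _ _ hg₂G hbc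
      by_cases hab : ((g₁ ∈ L (a i) ∨ g₁ ∈ L (b i)) ∧ (g₂ ∈ L (a i) ∨ g₂ ∈ L (b i)))
      · exact attrib (a i) (b i) g₁ g₂ hD' hab.1 hab.2
      by_cases hcd : ((g₁ ∈ L (c i) ∨ g₁ ∈ L (d i)) ∧ (g₂ ∈ L (c i) ∨ g₂ ∈ L (d i)))
      · exact attrib (c i) (d i) g₁ g₂ (by rw [hD', hw i]) hcd.1 hcd.2
      exfalso
      rcases lt_trichotomy g₁ g₂ with hlt | heq | hgt
      · have hab₁ : (u (a i) - u (b i)).order = g₁ := by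
          apply order_sub_eq_of_lt (u (a i)) (u (c i)) (u (b i)) g₁ hac
          rw [order_sub_comm, hbc]; exact_mod_cast hlt
        have hcd₁ : (u (c i) - u (d i)).order = g₁ := by
          apply order_sub_eq_of_lt (u (c i)) (u (a i)) (u (d i)) g₁ (by rw [order_sub_comm, hac])
          rw [had]; exact_mod_cast hlt
        exact prodDepth_core_lt hA' hB' hC' hE' hab hcd (hwit _ _ _ hg₁G hab₁) (hwit _ _ _ hg₁G hcd₁)
      · subst heq
        exact prodDepth_core_eq hA' hB' hab hcd
      · have hab₂ : (u (a i) - u (b i)).order = g₂ := by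
          apply order_sub_eq_of_lt (u (a i)) (u (d i)) (u (b i)) g₂ had
          rw [order_sub_comm, hbd]; exact_mod_cast hgt
        have hcd₂ : (u (c i) - u (d i)).order = g₂ := by
          apply order_sub_eq_of_lt (u (c i)) (u (b i)) (u (d i)) g₂ (by rw [order_sub_comm, hbc])
          rw [hbd]; exact_mod_cast hgt
        exact prodDepth_core_gt hA' hB' hC' hE' hab hcd (hwit _ _ _ hg₂G hab₂) (hwit _ _ _ hg₂G hcd₂)

end TwoByTwo

/-- **Registered helper stub `helper_twoByTwoCover`** (crux stmt-ValiantsHypothesis-6534, line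
`registered`): `exists_small_cover_of_twoByTwo` over `ℂ` with all binders — all non-deep 2×2-initiated
born exponents lie in `U + U` with `|U| ≤ n (log₂ n + 1)²`. [folklore] -/
theorem helper_twoByTwoCover : ∀ (n m : ℕ) (u : Fin n → PowerSeries ℂ) (o : Fin n → ℕ) (a b c d : Fin m → Fin n) (D γ : Fin m → ℕ), (∀ j, PowerSeries.constantCoeff (u j) ≠ 0) → (∀ i, D i = o (a i) + o (b i) + γ i) → (∀ i, o (a i) + o (b i) = o (c i) + o (d i)) → (∀ i, (u (a i) * u (b i) - u (c i) * u (d i)).order = (γ i : ℕ∞)) → (∀ i (g₁ g₂ : ℕ), (u (a i) - u (c i)).order = (g₁ : ℕ∞) → (u (b i) - u (d i)).order = (g₁ : ℕ∞) → (u (a i) - u (d i)).order = (g₂ : ℕ∞) → (u (b i) - u (c i)).order = (g₂ : ℕ∞) → g₁ < γ i → g₂ < γ i → γ i = g₁ + g₂) → ∃ U : Finset ℕ, U.card ≤ n * (Nat.log 2 n + 1) ^ 2 ∧ ∀ i, ∃ p ∈ U, ∃ q ∈ U, D i = p + q :=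
  fun _ _ u o a b c d D γ hu hD hw hγ hnd =>
    exists_small_cover_of_twoByTwo u hu o a b c d D γ hD hw hγ hnd

end Summit.ValiantsHypothesis.ValiantsHypothesis.Theorems
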